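/-
COR-CM (cell pub-hodgecm2, stage 2 of the Hodge ladder) — count-neutral KERNEL CENSUS TRANSPORT «the MARKMAN COLUMN», degree 12, type
`D₆` (`DihedralGroup 6`, `c = r 3`) — CLOSED automorphism form on Markman's fourfold theorem (seat prover-pub-hodgecm2-b23-g34-0, binder prover b23, gen 34; own lane DEG12-MARKMAN-TRANSPORT,
HOME/LIT-CLAIMS.md l.1451, HOME/INBOX.md l.5632; seat b07's ORBIT-COUNT v2 §7.3/§7.4 offer by adjacency; sequel of
`Census/DuodecicFaceTransportDihedral.lean` (b23) on seat b09's DECIC-MARKMAN pattern `Census/DecicFaceTransportOfMarkman.lean`, generic part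
`CorCM/FaceCensusMarkmanColumn.lean`).  Theorems only; no definition, no named fact, nothing asserted; the census data `Γ` of
`Census/DuodecicFaceGeneratorsDihedral.lean` BY NAME; `Interfaces.lean` (C1), every E term, `B01/*`, `Transposition/*` untouched.
HONEST FRAMING (COORDINATOR RULING — HODGE FRAMING CORRECTION, 2026-08-21T11:55:35Z): `HC_CM` is NOT proved, here or anywhere in the
tree; nothing here produces a period or proves a case of the Hodge conjecture.
T5 (coordinator ruling 15:33:56Z (3)): binder set of the headline = b23's landed `…_duodecicDihedral_aut` set {dictionary (σ₀, ε, hε, c, hc, hεc), face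
descriptions, face periods} MINUS 4 face period(s) PLUS {`Markman2025_weilClasses_algebraic_abelianFourfold` (the cell's standing named fact,
E. Markman, UNREFEREED)}; the type data and `hHC` binders of the GalT-form transport are DISCHARGED here by seat b09's
`DuodecicMarkmanFamilies.exists_families_d6` (consumed BY NAME); no `¬` theorem in the tree against any binder; no contradiction derivable;
checker: self (prover-pub-hodgecm2-b23-g34-0), 2026-08-21.
-/
import Summits.HodgeConjecture.CorCM.Census.DuodecicFaceTransportDihedralOfMarkman
import Summits.HodgeConjecture.CorCM.DuodecicMarkmanFamilies
import HarnessLib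

/-!
# Degree 12, type `D₆` (`DihedralGroup 6`, `c = r 3`): 4 face periods + Markman's FOURFOLD theorem close the slice (automorphism form, CLOSED)

The last file of the lane: composition BY NAME of the census transport with the Markman column
(`Census/DuodecicFaceTransportDihedralOfMarkman.lean`: 4 face periods + `HodgeConjectureFor` of 4 tree product(s) `cmProdAV K h₃ 1 ![E, T]` for
code-read types) with seat b09's `CorCM/DuodecicMarkmanFamilies.lean` (`DuodecicMarkmanFamilies.exists_families_d6`: under the automorphism
dictionary the code-read types EXIST and those products satisfy the Hodge conjecture GIVEN ONLY `Markman2025_weilClasses_algebraic_abelianFourfold`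
— `E = Ψ^K`, `T = Φ^K` for types of the subfields `K^H` read off the codes, seat b09's `CorCM/FaceCensusInducedTypes.lean`, and seat b07's
`InducedCurveThreefold.hodgeConjectureFor_cmProdAV_inducedCMType_pair_of_markman`).  The families:

* `![E₀, T₁]` reading `(2730, 952)` — the type of `K` induced from the type `{σ̄₀|_{k₀}}` of the imaginary quadratic subfield `k₀ = K^{⟨r², s⟩}` (mask `2730` = complement of `Gal(K/k₀) = {0,2,4,6,8,10}`); induced from the sextic CM subfield `L₀ = K^{⟨s⟩}` (left cosets `r³⟨s⟩ ∪ r⁴⟨s⟩ ∪ r⁵⟨s⟩`, mask `952`; a threefold type NOT induced from `k₀`)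
* `![E₀, T₂]` reading `(2730, 3598)` — the type of `K` induced from the type `{σ̄₀|_{k₀}}` of the imaginary quadratic subfield `k₀ = K^{⟨r², s⟩}` (mask `2730` = complement of `Gal(K/k₀) = {0,2,4,6,8,10}`); induced from `L₀ = K^{⟨s⟩}` (`r⟨s⟩ ∪ r²⟨s⟩ ∪ r³⟨s⟩`, mask `3598`)
* `![E₁, T₃]` reading `(1386, 924)` — the type induced from `{σ̄₀|_{k₁}}`, `k₁ = K^{⟨r², sr⟩}` (mask `1386` = complement of `{0,2,4,7,9,11}`); induced from `L₅ = K^{⟨sr⁵⟩}` (`r²⟨sr⁵⟩ ∪ r³⟨sr⁵⟩ ∪ r⁴⟨sr⁵⟩`, mask `924`; NOT induced from `k₁`)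
* `![E₁, T₄]` reading `(1386, 1806)` — the type induced from `{σ̄₀|_{k₁}}`, `k₁ = K^{⟨r², sr⟩}` (mask `1386` = complement of `{0,2,4,7,9,11}`); induced from `L₅ = K^{⟨sr⁵⟩}` (`r⟨sr⁵⟩ ∪ r²⟨sr⁵⟩ ∪ r³⟨sr⁵⟩`, mask `1806`)

HEADLINES: `…_duodecicDihedral_of_markman_aut` — for a Galois CM field `K` with the AUTOMORPHISM dictionary of this type (`σ₀`,
`ε : Aut(K) ≃ Fin 12` multiplicative for b30's table, `c` the conjugation at `σ₀` with `ε c = 3`) and 4 faces described through `ε` as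
`(455;9,18)`, `(455;9,36)`, `(455;9,1152)`, `(469;9,36)`:

  ONE period witness on each of these 4 faces ∧ Markman's fourfold theorem
    ⟹ the Hodge conjecture, in every codimension, for every complex abelian variety dominated by a finite product of abelian varieties
      realising CM types of CM fields embeddable in `K`;

and, in `Census/DuodecicFaceTransportDihedralOfMarkmanMulEquiv.lean`, `…_duodecicDihedral_of_markman_mulEquiv` — the same from
`e : Gal(K/ℚ) ≃* DihedralGroup 6` (seat b23 gen 33's intrinsic dictionary).  Seat b23's landed `…_duodecicDihedral_aut` / `…_mulEquiv` need 8 face periods and no named fact.  `HC_CM` is NOT proved; no period is produced here.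

References: [cite: Markman2025SurveySecant, Thm. 1.2]; [cite: Pohlmann1968, Thm. 1]; [cite: Milne1999LefschetzClasses, Thm. 3.2 and Cor. 4.5];
[cite: Shimura1998, §6.2 Theorem 3, §6.1 Corollary of Theorem 2 (pp. 41–43), §8.2 Prop. 26]; [cite: MumfordAV1970, §19 Thm. 1 and p. 169].
-/

noncomputable section

open CategoryTheory NumberField NumberField.ComplexEmbedding
open Literature.AlgebraicGeometry Literature.AlgebraicGeometry.Motives Literature.AlgebraicGeometry.HodgeTheory
open Literature.AlgebraicGeometry.ComplexMultiplication Literature.AlgebraicGeometry.Milne1999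
open Literature.NumberTheory.Automorphic Literature.NumberTheory.Automorphic.PicardCM
open Literature.NumberTheory.ComplexMultiplication.CMTypeOps
open Summit.HodgeConjecture.CorCM.Prior.AllgGroup.RfwfAllgGroup
open Summit.HodgeConjecture.CorCM.Census.FaceSquaresModel
open Summit.HodgeConjecture.CorCM.Census.DuodecicFaceGeneratorsDihedral (Γ)
open Summit.HodgeConjecture.CorCM.FaceCensus
open Summit.HodgeConjecture.CorCM.Domination

namespace Summit.HodgeConjecture.CorCM.DuodecicFaceTransport.DihedralMarkman

/-- **FIELD CLOSURE, type `D₆` (`DihedralGroup 6`, `c = r 3`) — 4 face periods + Markman's fourfold theorem, from AUTOMORPHISM data (CLOSED headline).**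
`K` a Galois CM field, `σ₀` a base embedding, `ε : Aut(K) ≃ Fin 12` multiplicative for b30's table, `c` the automorphism inducing complex
conjugation at `σ₀` with `ε c = 3`; faces `R₁`, `R₂`, `R₄`, `R₈` of `K` described through `ε` as `(455;9,18)`, `(455;9,36)`, `(455;9,1152)`, `(469;9,36)`
(`σ₀ ∘ g ∈ Rᵢ.Φ ↔ ε g ∈` type mask; place representatives `σ₀ ∘ g_p`, `σ₀ ∘ g_q` with the listed place masks).  ONE period witness for each of
these 4 faces on the universe of record together with Markman's fourfold theorem implies the Hodge conjecture, in every codimension, for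
every complex abelian variety dominated by a finite product of abelian varieties realising CM types of CM fields embeddable in `K`.  NO other
hypothesis: the code-read types and their Markman inputs come from `DuodecicMarkmanFamilies.exists_families_d6` (seat b09).  (FRAMING: conditional on
these 4 face periods — instances of the crux — and on Markman's UNREFEREED theorem; seat b23's `…_duodecicDihedral_aut` needs 8 periods;
`HC_CM` is not proved.) [cite: Markman2025SurveySecant, Thm. 1.2] [cite: Shimura1998, §6.2 Theorem 3 and §6.1 Corollary of Theorem 2 (pp. 41–43)]
[cite: Pohlmann1968, Thm. 1] [cite: Milne1999LefschetzClasses, Thm. 3.2 and Cor. 4.5] [cite: MumfordAV1970, §19 Thm. 1 and p. 169] -/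
theorem hodgeConjectureFor_of_avDominatedBy_isProductOf_of_facePeriods_duodecicDihedral_of_markman_aut
    (hW4 : Markman2025_weilClasses_algebraic_abelianFourfold) (K : CMField) [IsGalois ℚ K]
    (σ₀ : (K : Type) →+* ℂ) (ε : ((K : Type) ≃ₐ[ℚ] (K : Type)) ≃ Fin 12) (hε : ∀ g h : ((K : Type) ≃ₐ[ℚ] (K : Type)), ε (g * h) = Γ.mul (ε g) (ε h))
    (c : ((K : Type) ≃ₐ[ℚ] (K : Type))) (hc : σ₀.comp (c : (K : Type) →+* (K : Type)) = conjugate σ₀) (hεc : ε c = Γ.conj)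
    (R₁ R₂ R₄ R₈ : Face K) (g₁ g₁' : ((K : Type) ≃ₐ[ℚ] (K : Type))) (g₂ g₂' : ((K : Type) ≃ₐ[ℚ] (K : Type))) (g₄ g₄' : ((K : Type) ≃ₐ[ℚ] (K : Type))) (g₈ g₈' : ((K : Type) ≃ₐ[ℚ] (K : Type)))
    (hΦ₁ : ∀ g : ((K : Type) ≃ₐ[ℚ] (K : Type)),
      σ₀.comp (g : (K : Type) →+* (K : Type)) ∈ R₁.Φ.1 ↔ mem (ε g) 455 = true)
    (hp₁ : R₁.p = σ₀.comp (g₁ : (K : Type) →+* (K : Type))) (hp₁' : Γ.placeMask (ε g₁) = 9)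
    (hq₁ : R₁.p' = σ₀.comp (g₁' : (K : Type) →+* (K : Type))) (hq₁' : Γ.placeMask (ε g₁') = 18)
    (hΦ₂ : ∀ g : ((K : Type) ≃ₐ[ℚ] (K : Type)),
      σ₀.comp (g : (K : Type) →+* (K : Type)) ∈ R₂.Φ.1 ↔ mem (ε g) 455 = true)
    (hp₂ : R₂.p = σ₀.comp (g₂ : (K : Type) →+* (K : Type))) (hp₂' : Γ.placeMask (ε g₂) = 9)
    (hq₂ : R₂.p' = σ₀.comp (g₂' : (K : Type) →+* (K : Type))) (hq₂' : Γ.placeMask (ε g₂') = 36)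
    (hΦ₄ : ∀ g : ((K : Type) ≃ₐ[ℚ] (K : Type)),
      σ₀.comp (g : (K : Type) →+* (K : Type)) ∈ R₄.Φ.1 ↔ mem (ε g) 455 = true)
    (hp₄ : R₄.p = σ₀.comp (g₄ : (K : Type) →+* (K : Type))) (hp₄' : Γ.placeMask (ε g₄) = 9)
    (hq₄ : R₄.p' = σ₀.comp (g₄' : (K : Type) →+* (K : Type))) (hq₄' : Γ.placeMask (ε g₄') = 1152)
    (hΦ₈ : ∀ g : ((K : Type) ≃ₐ[ℚ] (K : Type)),
      σ₀.comp (g : (K : Type) →+* (K : Type)) ∈ R₈.Φ.1 ↔ mem (ε g) 469 = true)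
    (hp₈ : R₈.p = σ₀.comp (g₈ : (K : Type) →+* (K : Type))) (hp₈' : Γ.placeMask (ε g₈) = 9)
    (hq₈ : R₈.p' = σ₀.comp (g₈' : (K : Type) →+* (K : Type))) (hq₈' : Γ.placeMask (ε g₈') = 36)
    (h₁ : ∃ ι₁ : K →+* ℂ, R₁.Admissible ι₁ ∧ ∃ (V : HermSpace3 K ι₁) (σ : K →+* ℂ),
      (Model.picardCMUniverse exists_isReal_hodgeModel_holds hodgePQ_independent_of_hodgeModel_holds
        BallQuotient.ballQuotientUniformised_holds cmAbelianVarietyRealised_holds).PeriodNV ι₁ V K R₁.psi σ)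
    (h₂ : ∃ ι₁ : K →+* ℂ, R₂.Admissible ι₁ ∧ ∃ (V : HermSpace3 K ι₁) (σ : K →+* ℂ),
      (Model.picardCMUniverse exists_isReal_hodgeModel_holds hodgePQ_independent_of_hodgeModel_holds
        BallQuotient.ballQuotientUniformised_holds cmAbelianVarietyRealised_holds).PeriodNV ι₁ V K R₂.psi σ)
    (h₄ : ∃ ι₁ : K →+* ℂ, R₄.Admissible ι₁ ∧ ∃ (V : HermSpace3 K ι₁) (σ : K →+* ℂ),
      (Model.picardCMUniverse exists_isReal_hodgeModel_holds hodgePQ_independent_of_hodgeModel_holds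
        BallQuotient.ballQuotientUniformised_holds cmAbelianVarietyRealised_holds).PeriodNV ι₁ V K R₄.psi σ)
    (h₈ : ∃ ι₁ : K →+* ℂ, R₈.Admissible ι₁ ∧ ∃ (V : HermSpace3 K ι₁) (σ : K →+* ℂ),
      (Model.picardCMUniverse exists_isReal_hodgeModel_holds hodgePQ_independent_of_hodgeModel_holds
        BallQuotient.ballQuotientUniformised_holds cmAbelianVarietyRealised_holds).PeriodNV ι₁ V K R₈.psi σ)
    {P A : AbelianVariety ℂ} (hP : AbelianVariety.IsProductOf (fun B : AbelianVariety ℂ =>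
      ∃ (E : Type) (_ : Field E) (_ : NumberField E) (_ : IsCMField E) (_ : E →+* (K : Type)) (Φ : CMType E)
        (ι : 𝓞 E →+* End B) (θ : E →+* Module.End ℂ (complexBetti B.X 1)),
        IsCMTypeRealisation Φ B ι θ) P)
    (hA : AVDominatedBy A P) : HodgeConjectureFor A.dim A.X := by
  obtain ⟨e, hmul, he⟩ := exists_enum_of_autEnum Γ σ₀ ε hε
  have hconj : e conjT = Γ.conj := by rw [conjT_eq_translate σ₀, ← hc, he, hεc]
  obtain ⟨E₀, E₁, T₁, T₂, T₃, T₄, hE₀, hE₁, hT₁, hT₂, hT₃, hT₄, hHC₁, hHC₂, hHC₃, hHC₄⟩ :=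
    DuodecicMarkmanFamilies.exists_families_d6 hW4 σ₀ ε hε c hc hεc
  exact hodgeConjectureFor_of_avDominatedBy_isProductOf_of_facePeriods_of_hodgeConjectureFor_duodecicDihedral K e hmul hconj σ₀ R₁ R₂ R₄ R₈
    (reads_of_autEnum Γ e σ₀ ε he R₁ hΦ₁ hp₁ hp₁' hq₁ hq₁')
    (reads_of_autEnum Γ e σ₀ ε he R₂ hΦ₂ hp₂ hp₂' hq₂ hq₂')
    (reads_of_autEnum Γ e σ₀ ε he R₄ hΦ₄ hp₄ hp₄' hq₄ hq₄')
    (reads_of_autEnum Γ e σ₀ ε he R₈ hΦ₈ hp₈ hp₈' hq₈ hq₈')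
    E₀ E₁ T₁ T₂ T₃ T₄
    (reads_galT_of_reads_aut ε σ₀ he hE₀)
    (reads_galT_of_reads_aut ε σ₀ he hE₁)
    (reads_galT_of_reads_aut ε σ₀ he hT₁)
    (reads_galT_of_reads_aut ε σ₀ he hT₂)
    (reads_galT_of_reads_aut ε σ₀ he hT₃)
    (reads_galT_of_reads_aut ε σ₀ he hT₄)
    hHC₁ hHC₂ hHC₃ hHC₄
    h₁ h₂ h₄ h₈ hP hA

end Summit.HodgeConjecture.CorCM.DuodecicFaceTransport.DihedralMarkman

end
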